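import Mathlib
import Literature.Analysis.ValidatedNumerics.WeightedEllOneKernelComposition
import HarnessLib

/-!
# Weighted `ℓ¹` as a Banach space: kernel operators with a column bound are bounded linear maps

The `ContinuousLinearMap` bridge between the column-sum lemmas of
`…ValidatedNumerics.WeightedEllOneSequenceAlgebra` / `…WeightedEllOneKernelComposition` (plain
families `a : ι → ℝ` with `Mem ω a`, `wnorm ω a`, kernel operators `apply M`, weighted column
bounds `ColBound ω ω' M C`) and the abstract closing theorems of the radii-polynomial /
Newton–Kantorovich layer, which are stated on a complete normed space `X` with maps `X →L[ℝ] X`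
(`Literature.Analysis.Calculus.existsUnique_affine_zero_of_norm_id_sub_le`,
`…Certificates.RadiiPolynomialCertificate.ContractionCert.sound` / `QuadraticCert.sound`,
`Literature.Analysis.Calculus.RadiiPolynomialTwoRadii`).  The closing on `ℓ¹_ω` itself is the
sibling file `WeightedEllOneContractionClosing`.

## Source and verbatim statements

* [HungriaLessardMirelesJames2016] A. Hungria, J.-P. Lessard, J. D. Mireles James, *Rigorous
  numerics for analytic solutions of differential equations: the radii polynomial approach*,
  Math. Comp. 85 (2016) 1427–1459, doi:10.1090/mcom/3046 (held `paper:doi-10-1090-mcom-3046`,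
  pages re-read 2026-08-27).
  - (1.2), p. 1429: "`‖c‖_ν = Σ_{k∈ℤ} |c_k| ν^{|k|}`, for some fixed weight `ν ≥ 1`."
  - §2.1, p. 1433: "We note that `ℓ¹_ν` is a Banach space and moreover has the property of
    being a Banach algebra under discrete convolution"; "Denote by `B(ℓ¹_ν, ℓ¹_ν)` the set of
    bounded linear operators from `ℓ¹_ν` to `ℓ¹_ν`, and given `A ∈ B(ℓ¹_ν, ℓ¹_ν)`, denote its
    operator norm by `‖A‖_{B(ℓ¹_ν,ℓ¹_ν)}`."
  - Corollary 1, p. 1434: "Then `A ∈ B(ℓ¹_ν, ℓ¹_ν)` and `‖A‖_{B(ℓ¹_ν,ℓ¹_ν)} ≤ max(K, δ)`, where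
    `K = max_{|n|<m} (1/ν^{|n|}) Σ_{|k|<m} |A_{k,n}| ν^{|k|}`" (operator norm ≤ sup of the
    weighted column norms).
  - §5.2, (5.13)–(5.14), p. 1453: "`DT(ā + b)c = [I − ADF(ā + b)]c = [I − AA†]c − A[DF(ā + b)c −
    A†c]`" … "Hence, by Corollary 1 `‖[I − AA†]c‖_ν ≤ Z^{(0)} r`."

## What is formalised (all PROVED; NO instance, notation or axiom is introduced — the Banach
## structure is Mathlib's `lp (fun _ : ι => ℝ) 1`, written `ℓ¹(ι, ℝ)` with Mathlib's scoped notation,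
## for a general index type `ι` and a positive weight `ω : ι → ℝ`)

1. **Carrier** (§1): `toEll1 ω a := (a i · ω i)_i ∈ ℓ¹(ι, ℝ)` and `ofEll1 ω x := (x i / ω i)_i` are
   mutually inverse between `{a | Mem ω a}` and `ℓ¹(ι, ℝ)`, additive and homogeneous, with
   `‖toEll1 ω a‖ = wnorm ω a` and `wnorm ω (ofEll1 ω x) = ‖x‖`: `(Mem ω, wnorm ω)` IS the Banach
   space `ℓ¹_ω` of the source, realised inside Mathlib's complete space `ℓ¹(ι, ℝ)`.
2. **Kernel operators are bounded** (§2, Corollary 1 as an operator statement):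
   `ColBound ω ω' M C` yields `kerCLM … : ℓ¹(ι, ℝ) →L[ℝ] ℓ¹(ι', ℝ)` acting as `apply M` in
   weighted coordinates, with `‖kerCLM …‖ ≤ C`; `T_A ∘ T_M = T_{kerComp A M}`; injectivity
   transfers from `apply M`; and the `Z`-kernel bound `ColBound ω ω (oneSubKer A M) Z` gives
   **`‖id − T_A ∘ T_M‖ ≤ Z`** — the hypothesis `hZ` of every closing theorem (`X = (ℓ¹_ν(cos))⁴`
   with the sum norm, the space of certnum-ode-2's F2 route (A), is `ι := Fin 4 × ℕ`,
   `ω (r, k) := ν^k`).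

## What is NOT covered

No float or interval model (column sums enter as hypotheses — exact kernel data or a client's
interval arithmetic discharge them); no Fréchet derivative of NONLINEAR maps on `ℓ¹(ι, ℝ)` (the
derivative `h ↦ 2 ū ⋆ h` of a quadratic nonlinearity is itself a kernel operator, but its
`HasFDerivAt` statement is left to a sibling file); real coefficients only.
-/

noncomputable section

open scoped lp
open Metric

namespace Literature.Analysis.ValidatedNumerics.WeightedSeq

variable {ι : Type*} {ω : ι → ℝ}

/-! ### 1. `ℓ¹_ω` inside Mathlib's Banach space `ℓ¹(ι, ℝ)` -/

section Carrier

/-- `Mem ω a` ⇒ the rescaled family `(a i · ω i)_i` is in Mathlib's `ℓ¹`.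
[cite: HungriaLessardMirelesJames2016, §2.1 p. 1433 ("ℓ¹_ν is a Banach space")] -/
theorem memℓp_mul_weight (hω : ∀ i, 0 ≤ ω i) {a : ι → ℝ} (ha : Mem ω a) :
    Memℓp (fun i => a i * ω i) 1 := by
  refine memℓp_gen ?_
  have h : (fun i => ‖a i * ω i‖ ^ (1 : ENNReal).toReal) = fun i => |a i| * ω i := by
    funext i
    rw [ENNReal.toReal_one, Real.rpow_one, Real.norm_eq_abs, abs_mul, abs_of_nonneg (hω i)]
  rw [h]
  exact ha

/-- **The embedding `ℓ¹_ω → ℓ¹(ι, ℝ)`**, `a ↦ (a i · ω i)_i` (and `0` on families outside `ℓ¹_ω`,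
an irrelevant junk value). [cite: HungriaLessardMirelesJames2016, §2.1 p. 1433 ("ℓ¹_ν is a Banach space")] -/
def toEll1 (ω : ι → ℝ) (a : ι → ℝ) : ℓ¹(ι, ℝ) := by
  classical
  exact if h : Memℓp (fun i => a i * ω i) 1 then ⟨fun i => a i * ω i, h⟩ else 0

/-- **The inverse map `ℓ¹(ι, ℝ) → ℓ¹_ω`**, `x ↦ (x i / ω i)_i`.
[cite: HungriaLessardMirelesJames2016, §2.1 p. 1433 ("ℓ¹_ν is a Banach space")] -/
def ofEll1 (ω : ι → ℝ) (x : ℓ¹(ι, ℝ)) : ι → ℝ := fun i => x i / ω i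

/-- [cite: HungriaLessardMirelesJames2016, §2.1 p. 1433] -/
theorem toEll1_apply (hω : ∀ i, 0 ≤ ω i) {a : ι → ℝ} (ha : Mem ω a) (i : ι) :
    toEll1 ω a i = a i * ω i := by
  classical
  simp only [toEll1, dif_pos (memℓp_mul_weight hω ha)]

/-- [cite: HungriaLessardMirelesJames2016, §2.1 p. 1433] -/
theorem ofEll1_apply (x : ℓ¹(ι, ℝ)) (i : ι) : ofEll1 ω x i = x i / ω i := rfl

/-- Every `x ∈ ℓ¹(ι, ℝ)` comes from `ℓ¹_ω`: `ofEll1 ω x ∈ ℓ¹_ω`.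
[cite: HungriaLessardMirelesJames2016, §2.1 p. 1433] -/
theorem mem_ofEll1 (hω : ∀ i, 0 < ω i) (x : ℓ¹(ι, ℝ)) : Mem ω (ofEll1 ω x) := by
  have hs : Summable fun i => ‖x i‖ ^ (1 : ENNReal).toReal :=
    (lp.memℓp x).summable (by simp)
  refine (hs.congr fun i => ?_)
  rw [ENNReal.toReal_one, Real.rpow_one, Real.norm_eq_abs, ofEll1_apply, abs_div,
    abs_of_pos (hω i), div_mul_cancel₀ _ (hω i).ne']

/-- `‖x‖ = Σ_i |x i|` in `ℓ¹(ι, ℝ)` equals the weighted norm of `ofEll1 ω x`.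
[cite: HungriaLessardMirelesJames2016, §2.1 p. 1433] -/
theorem wnorm_ofEll1 (hω : ∀ i, 0 < ω i) (x : ℓ¹(ι, ℝ)) : wnorm ω (ofEll1 ω x) = ‖x‖ := by
  have h1 : ‖x‖ = ∑' i, ‖x i‖ := by
    simp [lp.norm_eq_tsum_rpow]
  rw [h1, wnorm]
  refine tsum_congr fun i => ?_
  rw [Real.norm_eq_abs, ofEll1_apply, abs_div, abs_of_pos (hω i), div_mul_cancel₀ _ (hω i).ne']

/-- `toEll1 ∘ ofEll1 = id`. [cite: HungriaLessardMirelesJames2016, §2.1 p. 1433] -/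
theorem toEll1_ofEll1 (hω : ∀ i, 0 < ω i) (x : ℓ¹(ι, ℝ)) : toEll1 ω (ofEll1 ω x) = x := by
  refine lp.ext (funext fun i => ?_)
  rw [toEll1_apply (fun i => (hω i).le) (mem_ofEll1 hω x), ofEll1_apply,
    div_mul_cancel₀ _ (hω i).ne']

/-- `ofEll1 ∘ toEll1 = id` on `ℓ¹_ω`. [cite: HungriaLessardMirelesJames2016, §2.1 p. 1433] -/
theorem ofEll1_toEll1 (hω : ∀ i, 0 < ω i) {a : ι → ℝ} (ha : Mem ω a) : ofEll1 ω (toEll1 ω a) = a := by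
  funext i
  rw [ofEll1_apply, toEll1_apply (fun i => (hω i).le) ha, mul_div_cancel_right₀ _ (hω i).ne']

/-- **Isometry**: `‖toEll1 ω a‖ = ‖a‖_ω`. [cite: HungriaLessardMirelesJames2016, §2.1 p. 1433 and (1.2) p. 1429 (the ν-norm)] -/
theorem norm_toEll1 (hω : ∀ i, 0 < ω i) {a : ι → ℝ} (ha : Mem ω a) : ‖toEll1 ω a‖ = wnorm ω a := by
  rw [← wnorm_ofEll1 hω (toEll1 ω a), ofEll1_toEll1 hω ha]

/-- `ofEll1` is injective (so equations may be transported either way).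
[cite: HungriaLessardMirelesJames2016, §2.1 p. 1433] -/
theorem ofEll1_injective (hω : ∀ i, 0 < ω i) : Function.Injective (ofEll1 ω) := by
  intro x y h
  rw [← toEll1_ofEll1 hω x, ← toEll1_ofEll1 hω y, h]

/-- [cite: HungriaLessardMirelesJames2016, §2.1 p. 1433] -/
theorem ofEll1_add (x y : ℓ¹(ι, ℝ)) : ofEll1 ω (x + y) = ofEll1 ω x + ofEll1 ω y := by
  funext i
  simp only [ofEll1_apply, Pi.add_apply, lp.coeFn_add, add_div]

/-- [cite: HungriaLessardMirelesJames2016, §2.1 p. 1433] -/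
theorem ofEll1_sub (x y : ℓ¹(ι, ℝ)) : ofEll1 ω (x - y) = ofEll1 ω x - ofEll1 ω y := by
  funext i
  simp only [ofEll1_apply, Pi.sub_apply, lp.coeFn_sub, sub_div]

/-- [cite: HungriaLessardMirelesJames2016, §2.1 p. 1433] -/
theorem ofEll1_smul (c : ℝ) (x : ℓ¹(ι, ℝ)) : ofEll1 ω (c • x) = c • ofEll1 ω x := by
  funext i
  simp only [ofEll1_apply, Pi.smul_apply, lp.coeFn_smul, smul_eq_mul, mul_div_assoc]

/-- [cite: HungriaLessardMirelesJames2016, §2.1 p. 1433] -/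
theorem toEll1_add (hω : ∀ i, 0 < ω i) {a b : ι → ℝ} (ha : Mem ω a) (hb : Mem ω b) :
    toEll1 ω (a + b) = toEll1 ω a + toEll1 ω b := by
  apply ofEll1_injective hω
  rw [ofEll1_add, ofEll1_toEll1 hω ha, ofEll1_toEll1 hω hb,
    ofEll1_toEll1 hω (ha.add (fun i => (hω i).le) hb)]

/-- [cite: HungriaLessardMirelesJames2016, §2.1 p. 1433] -/
theorem toEll1_sub (hω : ∀ i, 0 < ω i) {a b : ι → ℝ} (ha : Mem ω a) (hb : Mem ω b) :
    toEll1 ω (a - b) = toEll1 ω a - toEll1 ω b := by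
  apply ofEll1_injective hω
  rw [ofEll1_sub, ofEll1_toEll1 hω ha, ofEll1_toEll1 hω hb,
    ofEll1_toEll1 hω (ha.sub (fun i => (hω i).le) hb)]

/-- [cite: HungriaLessardMirelesJames2016, §2.1 p. 1433] -/
theorem toEll1_smul (hω : ∀ i, 0 < ω i) (c : ℝ) {a : ι → ℝ} (ha : Mem ω a) :
    toEll1 ω (c • a) = c • toEll1 ω a := by
  apply ofEll1_injective hω
  have hca : Mem ω (c • a) := by
    have := ha.const_mul c
    simpa [Pi.smul_def, smul_eq_mul] using this
  rw [ofEll1_smul, ofEll1_toEll1 hω ha, ofEll1_toEll1 hω hca]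

/-- Distances in `ℓ¹(ι, ℝ)` are weighted norms of differences: `‖toEll1 a − toEll1 b‖ = ‖a − b‖_ω`.
[cite: HungriaLessardMirelesJames2016, §2.1 p. 1433] -/
theorem norm_toEll1_sub_toEll1 (hω : ∀ i, 0 < ω i) {a b : ι → ℝ} (ha : Mem ω a) (hb : Mem ω b) :
    ‖toEll1 ω a - toEll1 ω b‖ = wnorm ω (a - b) := by
  rw [← toEll1_sub hω ha hb, norm_toEll1 hω (ha.sub (fun i => (hω i).le) hb)]

end Carrier

/-! ### 2. Kernel operators with a weighted column bound are bounded linear maps -/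

section KernelCLM

variable {ι' ι'' : Type*} {ω' : ι' → ℝ} {ω'' : ι'' → ℝ}

/-- `apply M` is additive on `ℓ¹_ω` (row series converge absolutely under a column bound).
[cite: HungriaLessardMirelesJames2016, Cor. 1 p. 1434] -/
theorem apply_add (hω : ∀ i, 0 ≤ ω i) (hω' : ∀ k, 0 < ω' k) {M : ι' → ι → ℝ} {C : ℝ}
    (hC : 0 ≤ C) (hcol : ColBound ω ω' M C) {a b : ι → ℝ} (ha : Mem ω a) (hb : Mem ω b) :
    apply M (a + b) = apply M a + apply M b := by
  funext k
  simp only [Pi.add_apply, apply]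
  rw [← (summable_apply_row hω hω' hC hcol ha k).tsum_add (summable_apply_row hω hω' hC hcol hb k)]
  exact tsum_congr fun m => by ring

/-- `apply M` is homogeneous. [cite: HungriaLessardMirelesJames2016, Cor. 1 p. 1434] -/
theorem apply_smul (M : ι' → ι → ℝ) (c : ℝ) (a : ι → ℝ) : apply M (c • a) = c • apply M a := by
  funext k
  simp only [Pi.smul_apply, smul_eq_mul, apply]
  rw [← tsum_mul_left]
  exact tsum_congr fun m => by ring

/-- **The kernel operator `T_M` as a bounded linear map `ℓ¹(ι, ℝ) →L[ℝ] ℓ¹(ι', ℝ)`** (weighted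
coordinates on both sides): Corollary 1 read as "column bound ⇒ `T_M ∈ B(ℓ¹_ω, ℓ¹_{ω'})`".
[cite: HungriaLessardMirelesJames2016, Cor. 1 p. 1434 ("A ∈ B(ℓ¹_ν, ℓ¹_ν) and ‖A‖ ≤ max(K, δ)")] -/
def kerCLM (hω : ∀ i, 0 < ω i) (hω' : ∀ k, 0 < ω' k) {M : ι' → ι → ℝ} {C : ℝ} (hC : 0 ≤ C)
    (hcol : ColBound ω ω' M C) : ℓ¹(ι, ℝ) →L[ℝ] ℓ¹(ι', ℝ) :=
  LinearMap.mkContinuous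
    { toFun := fun x => toEll1 ω' (apply M (ofEll1 ω x))
      map_add' := fun x y => by
        have hx := mem_ofEll1 hω x
        have hy := mem_ofEll1 hω y
        rw [ofEll1_add, apply_add (fun i => (hω i).le) hω' hC hcol hx hy,
          toEll1_add hω' (wnorm_apply_le (fun i => (hω i).le) (fun k => (hω' k).le) hC hcol hx).1
            (wnorm_apply_le (fun i => (hω i).le) (fun k => (hω' k).le) hC hcol hy).1]
      map_smul' := fun c x => by
        have hx := mem_ofEll1 hω x
        rw [ofEll1_smul, apply_smul, RingHom.id_apply,
          toEll1_smul hω' c (wnorm_apply_le (fun i => (hω i).le) (fun k => (hω' k).le) hC hcol hx).1] }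
    C
    (fun x => by
      have hx := mem_ofEll1 hω x
      obtain ⟨hm, hle⟩ := wnorm_apply_le (fun i => (hω i).le) (fun k => (hω' k).le) hC hcol hx
      simp only [LinearMap.coe_mk, AddHom.coe_mk]
      rw [norm_toEll1 hω' hm, ← wnorm_ofEll1 hω x]
      exact hle)

/-- `T_M` in weighted coordinates is `apply M`: `ofEll1 (kerCLM x) = apply M (ofEll1 x)`.
[cite: HungriaLessardMirelesJames2016, Cor. 1 p. 1434] -/
theorem ofEll1_kerCLM (hω : ∀ i, 0 < ω i) (hω' : ∀ k, 0 < ω' k) {M : ι' → ι → ℝ} {C : ℝ}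
    (hC : 0 ≤ C) (hcol : ColBound ω ω' M C) (x : ℓ¹(ι, ℝ)) :
    ofEll1 ω' (kerCLM hω hω' hC hcol x) = apply M (ofEll1 ω x) := by
  simp only [kerCLM, LinearMap.mkContinuous_apply, LinearMap.coe_mk, AddHom.coe_mk]
  exact ofEll1_toEll1 hω'
    (wnorm_apply_le (fun i => (hω i).le) (fun k => (hω' k).le) hC hcol (mem_ofEll1 hω x)).1

/-- `kerCLM (toEll1 a) = toEll1 (apply M a)` for `a ∈ ℓ¹_ω`.
[cite: HungriaLessardMirelesJames2016, Cor. 1 p. 1434] -/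
theorem kerCLM_toEll1 (hω : ∀ i, 0 < ω i) (hω' : ∀ k, 0 < ω' k) {M : ι' → ι → ℝ} {C : ℝ}
    (hC : 0 ≤ C) (hcol : ColBound ω ω' M C) {a : ι → ℝ} (ha : Mem ω a) :
    kerCLM hω hω' hC hcol (toEll1 ω a) = toEll1 ω' (apply M a) := by
  apply ofEll1_injective hω'
  rw [ofEll1_kerCLM, ofEll1_toEll1 hω ha,
    ofEll1_toEll1 hω' (wnorm_apply_le (fun i => (hω i).le) (fun k => (hω' k).le) hC hcol ha).1]

/-- **Operator norm ≤ column bound**: `‖T_M‖_{B(ℓ¹_ω, ℓ¹_{ω'})} ≤ C`.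
[cite: HungriaLessardMirelesJames2016, Cor. 1 p. 1434 ("‖A‖_{B(ℓ¹_ν,ℓ¹_ν)} ≤ max(K, δ)")] -/
theorem opNorm_kerCLM_le (hω : ∀ i, 0 < ω i) (hω' : ∀ k, 0 < ω' k) {M : ι' → ι → ℝ} {C : ℝ}
    (hC : 0 ≤ C) (hcol : ColBound ω ω' M C) : ‖kerCLM hω hω' hC hcol‖ ≤ C :=
  LinearMap.mkContinuous_norm_le _ hC _

/-- Injectivity transfers: `T_M` is injective on `ℓ¹(ι, ℝ)` iff `apply M` is injective on `ℓ¹_ω`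
(the hypothesis `hA : Injective A` of the abstract closing theorems).
[cite: HungriaLessardMirelesJames2016, Cor. 1 p. 1434] -/
theorem injective_kerCLM (hω : ∀ i, 0 < ω i) (hω' : ∀ k, 0 < ω' k) {M : ι' → ι → ℝ} {C : ℝ}
    (hC : 0 ≤ C) (hcol : ColBound ω ω' M C)
    (hinj : ∀ a : ι → ℝ, Mem ω a → apply M a = 0 → a = 0) :
    Function.Injective (kerCLM hω hω' hC hcol) := by
  refine (injective_iff_map_eq_zero _).2 fun x hx => ?_
  have hx0 : ofEll1 ω' (kerCLM hω hω' hC hcol x) = 0 := by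
    rw [hx]; funext i; simp only [ofEll1_apply, lp.coeFn_zero, Pi.zero_apply, zero_div]
  have h1 : apply M (ofEll1 ω x) = 0 := by rwa [ofEll1_kerCLM] at hx0
  apply ofEll1_injective hω
  rw [hinj _ (mem_ofEll1 hω x) h1]
  funext i; simp only [ofEll1_apply, lp.coeFn_zero, Pi.zero_apply, zero_div]

/-- **Composition**: `T_A ∘ T_M = T_{A·M}` as bounded maps (the composite kernel `kerComp`, column
bound `C₂ C₁`). [cite: HungriaLessardMirelesJames2016, Cor. 1 p. 1434] -/
theorem kerCLM_comp (hω : ∀ i, 0 < ω i) (hω' : ∀ j, 0 < ω' j) (hω'' : ∀ k, 0 < ω'' k)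
    {M : ι' → ι → ℝ} {A : ι'' → ι' → ℝ} {C₁ C₂ : ℝ} (hC₁ : 0 ≤ C₁) (hC₂ : 0 ≤ C₂)
    (hM : ColBound ω ω' M C₁) (hA : ColBound ω' ω'' A C₂) :
    (kerCLM hω' hω'' hC₂ hA).comp (kerCLM hω hω' hC₁ hM) =
      kerCLM hω hω'' (mul_nonneg hC₂ hC₁)
        (colBound_kerComp (fun k => (hω'' k).le) hC₂ hM hA) := by
  refine ContinuousLinearMap.ext fun x => ofEll1_injective hω'' ?_
  rw [ContinuousLinearMap.comp_apply, ofEll1_kerCLM, ofEll1_kerCLM, ofEll1_kerCLM,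
    apply_kerComp (fun i => (hω i).le) hω' hω'' hC₁ hC₂ hM hA (mem_ofEll1 hω x)]

/-- **The `Z`-bound as an operator-norm bound**: a weighted column bound `Z` of the kernel
`I − A·M` gives `‖id − T_A ∘ T_M‖_{B(ℓ¹_ω)} ≤ Z` — the hypothesis `hZ` of the closing theorems.
[cite: HungriaLessardMirelesJames2016, §5.2 (5.13)–(5.14) p. 1453 ("by Corollary 1, ‖[I − AA†]c‖_ν ≤ Z⁽⁰⁾ r")] -/
theorem opNorm_id_sub_comp_le [DecidableEq ι] (hω : ∀ i, 0 < ω i) (hω' : ∀ j, 0 < ω' j)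
    {A : ι → ι' → ℝ} {M : ι' → ι → ℝ} {C₁ C₂ Z : ℝ} (hC₁ : 0 ≤ C₁) (hC₂ : 0 ≤ C₂) (hZ0 : 0 ≤ Z)
    (hM : ColBound ω ω' M C₁) (hA : ColBound ω' ω A C₂) (hZ : ColBound ω ω (oneSubKer A M) Z) :
    ‖ContinuousLinearMap.id ℝ (ℓ¹(ι, ℝ)) - (kerCLM hω' hω hC₂ hA).comp (kerCLM hω hω' hC₁ hM)‖ ≤
      Z := by
  refine ContinuousLinearMap.opNorm_le_bound _ hZ0 fun x => ?_
  have hx := mem_ofEll1 hω x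
  have hMx := (wnorm_apply_le (fun i => (hω i).le) (fun j => (hω' j).le) hC₁ hM hx).1
  have hAMx := (wnorm_apply_le (fun j => (hω' j).le) (fun i => (hω i).le) hC₂ hA hMx).1
  obtain ⟨-, hle⟩ := wnorm_sub_apply_apply_le hω hω' hC₁ hC₂ hZ0 hM hA hZ hx
  have e : (ContinuousLinearMap.id ℝ (ℓ¹(ι, ℝ)) -
      (kerCLM hω' hω hC₂ hA).comp (kerCLM hω hω' hC₁ hM)) x =
      toEll1 ω (ofEll1 ω x - apply A (apply M (ofEll1 ω x))) := by
    rw [sub_apply, ContinuousLinearMap.id_apply,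
      ContinuousLinearMap.comp_apply, toEll1_sub hω hx hAMx, toEll1_ofEll1 hω x,
      ← kerCLM_toEll1 hω' hω hC₂ hA hMx, ← kerCLM_toEll1 hω hω' hC₁ hM hx, toEll1_ofEll1 hω x]
  rw [e, norm_toEll1 hω (hx.sub (fun i => (hω i).le) hAMx), ← wnorm_ofEll1 hω x]
  exact hle

end KernelCLM

end Literature.Analysis.ValidatedNumerics.WeightedSeq

end
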